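import Summits.BirchSwinnertonDyer.BirchSwinnertonDyer.Theorems.ResidualThetaTransportAtTwoResidualSignedLambdaLowerCMAtTwoColemanPairApZero
import Summits.BirchSwinnertonDyer.BirchSwinnertonDyer.Theorems.ResidualThetaTransportAtTwoResidualThetaMainConjectureAtTwoLimitFree
import Summits.BirchSwinnertonDyer.BirchSwinnertonDyer.Theorems.ResidualThetaTransportAtTwoLambdaLowerBoundO
import HarnessLib

/-!
# `Col⁺ ⊗ 𝒪` is ONTO `Λ_𝒪` at `p = 2` (functional model): every `F ∈ 𝒪⟦T⟧` is the plus Coleman value of an `𝒪`-VALUED functional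
# on `E(ℚ_{2,∞}·ℚ_v)`, for `𝒪` finite free over `ℤ₂` (e.g. `𝒪 = padicCoeffIntegers S`)

Route `ResidualThetaTransportAtTwo` (RTT), crux RSL_g `ResidualSignedLambdaLowerCMAtTwo` (stmt-BirchSwinnertonDyer-22608): DAG node N1 ⊗ 𝒪
(`RSLG-LINE-DAG-g14.md`; STUB-PLAN rev 4 §3.2 `stub_plusColemanO`, surjectivity half, in the functional model). Seat `prover-bsd-wall-rtt-p2`
g15 (`--supports`, closes nothing). Sequel of p656284 `…ColemanPairApZero` (`colemanFlat_onto_two`, the case `𝒪 = ℤ₂`). THEOREMS ONLY; BSD is not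
proved by any of this.

## What
* §1 (abstract, any `p`, any `𝒪` finite free over `ℤ_p`): **`exists_addMonoidHom_coeff_of_forall_exists`** — if for every `a ∈ ℤ_p⟦T⟧` there is
  a `ℤ_p`-valued additive functional `z` on an abelian group `A` with `ω_m ∣ Σ_j C(z(x_{m,j}))(X+1)^j + s_m·ω'_m·a` for all `m` (fixed orbit
  points `x_{m,j} ∈ A`, integer polynomials `ω_m, ω'_m`, integer signs `s_m`), then for every `F ∈ 𝒪⟦T⟧` there is an `𝒪`-valued functional
  `z : A →+ 𝒪` with the same congruences for `F` — coordinates in a `ℤ_p`-basis `(b_i)` of `𝒪`, `z := Σ_i b_i·z_i`.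
* §2 (`p = 2`) **`colemanPlus_onto_two_coeff`** — for `W/ℚ` globally minimal, `GoodSS W 2`, `a₂(W) = 0`, cyclotomic `κ`, `v ∋ 2`, and `𝒪` finite
  free over `ℤ₂`: there are a local lift `g` of the topological generator and a plus Honda family `d` ((L), (TR), (ND)) such that for EVERY
  `F ∈ 𝒪⟦T⟧` some `z : E(ℚ_{2,∞}·ℚ_v) →+ 𝒪` has `ω_{2m} ∣ Σ_{j<4^m} C(z(gʲ·d_{2m}))(X+1)^j + (−1)^m·ω⁻_{2m}·F` for all `m` (Sprung's sign convention of
  `IsColemanPair` at even levels, `a_p = 0`: `v_{2m} = (−1)^m ω⁻_{2m}`, `u_{2m} = 0`). With `…PairingSumPlusValueCoeff` (existence of the value for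
  every `𝒪`-valued functional) this is `Col⁺_𝒪 : Hom(E(ℚ_{2,∞}·ℚ_v), 𝒪) ↠ Λ_𝒪` at `p = 2`; `colemanPlus_onto_two_padicCoeffIntegers` = the same on
  `𝒪 = padicCoeffIntegers S`, `Λ_𝒪 = IwasawaAlgebraO S`.

References: [Kobayashi2003] Thm. 6.2 (6.13) (p. 11), Prop. 8.23 (p. 22); [Sprung2012] Prop. 7.3, Def. 5.9; [Sprung2017] Cor. 4.4.
-/

set_option autoImplicit false
-- the Theorems namespace of this sub repeats the summit name by design (D-0017 nested layout)
set_option linter.dupNamespace false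

noncomputable section

open scoped Classical
open Polynomial Finset

namespace Summit.BirchSwinnertonDyer.BirchSwinnertonDyer.Theorems.SignedColemanImage

open Literature.NumberTheory.EllipticCurves Literature.NumberTheory.EllipticCurves.Sprung2017
  Literature.NumberTheory.EllipticCurves.Kobayashi2003 Summit.BirchSwinnertonDyer.Rank1Residual.Supersingular

/-! ## §1 `⊗ 𝒪` by coordinates: from `ℤ_p`-valued to `𝒪`-valued functionals -/

section Coeff

variable {p : ℕ} [Fact p.Prime] {O : Type*} [CommRing O] [Algebra ℤ_[p] O] [Module.Free ℤ_[p] O] [Module.Finite ℤ_[p] O]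

omit [Module.Free ℤ_[p] O] [Module.Finite ℤ_[p] O] in
/-- An integer polynomial read in `𝒪⟦T⟧` is the image of its reading in `ℤ_p⟦T⟧`. [folklore] -/
theorem coe_map_intCastRingHom_eq_map (ω : ℤ[X]) :
    ((ω.map (Int.castRingHom O) : O[X]) : PowerSeries O) =
      PowerSeries.map (algebraMap ℤ_[p] O) ((ω.map (Int.castRingHom ℤ_[p]) : ℤ_[p][X]) : PowerSeries ℤ_[p]) := by
  rw [← Polynomial.polynomial_map_coe, Polynomial.map_map, RingHom.ext_int ((algebraMap ℤ_[p] O).comp _) (Int.castRingHom O)]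

/-- **`⊗ 𝒪` by coordinates.** Let `A` be an abelian group with orbit points `x m j ∈ A`, `ω ω' : ℕ → ℤ[X]`, signs `s : ℕ → ℤ`, ranges `N`. If for
every `a ∈ ℤ_p⟦T⟧` some `z : A →+ ℤ_p` has `ω_m ∣ Σ_{j<N m} C(z(x m j))(X+1)^j + s_m·ω'_m·a` in `ℤ_p⟦T⟧` for all `m`, then for every `F ∈ 𝒪⟦T⟧`
(`𝒪` finite free over `ℤ_p`) some `z : A →+ 𝒪` has the same congruences for `F` in `𝒪⟦T⟧` (`z := Σ_i b_i·z_i` for the coordinates `F_i` of `F`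
in a `ℤ_p`-basis `(b_i)` of `𝒪`). [cite: Kobayashi2003, Thm. 6.2 (p. 11)] -/
theorem exists_addMonoidHom_coeff_of_forall_exists {A : Type*} [AddCommGroup A] (x : ℕ → ℕ → A) (N : ℕ → ℕ)
    (ω ω' : ℕ → ℤ[X]) (s : ℕ → ℤ)
    (honto : ∀ a : PowerSeries ℤ_[p], ∃ z : A →+ ℤ_[p], ∀ m : ℕ,
      (((ω m).map (Int.castRingHom ℤ_[p]) : ℤ_[p][X]) : PowerSeries ℤ_[p]) ∣
        ((∑ j ∈ range (N m), C (z (x m j)) * (X + 1) ^ j : ℤ_[p][X]) : PowerSeries ℤ_[p]) +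
          (s m : PowerSeries ℤ_[p]) * (((ω' m).map (Int.castRingHom ℤ_[p]) : ℤ_[p][X]) : PowerSeries ℤ_[p]) * a)
    (F : PowerSeries O) :
    ∃ z : A →+ O, ∀ m : ℕ,
      (((ω m).map (Int.castRingHom O) : O[X]) : PowerSeries O) ∣
        ((∑ j ∈ range (N m), C (z (x m j)) * (X + 1) ^ j : O[X]) : PowerSeries O) +
          (s m : PowerSeries O) * (((ω' m).map (Int.castRingHom O) : O[X]) : PowerSeries O) * F := by
  classical
  set b := Module.Free.chooseBasis ℤ_[p] O with hb
  haveI : Fintype (Module.Free.ChooseBasisIndex ℤ_[p] O) := Module.Free.ChooseBasisIndex.fintype ℤ_[p] O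
  set φ : ℤ_[p] →+* O := algebraMap ℤ_[p] O with hφ
  -- coordinates of `F`
  obtain ⟨Fc, hF⟩ : ∃ Fc : Module.Free.ChooseBasisIndex ℤ_[p] O → PowerSeries ℤ_[p],
      F = ∑ i, PowerSeries.C (b i) * PowerSeries.map φ (Fc i) :=
    ⟨fun i ↦ PowerSeries.mk fun k ↦ b.repr (PowerSeries.coeff k F) i, by
      ext n; rw [ResidualThetaLayer.coeff_sum_C_mul_map_eq b F n]⟩
  choose zc hzc using fun i ↦ honto (Fc i)
  -- the `𝒪`-valued functional `z := Σ_i b_i · z_i`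
  obtain ⟨z, hz⟩ : ∃ z : A →+ O, ∀ y, z y = ∑ i, b i * φ (zc i y) :=
    ⟨∑ i, (AddMonoidHom.mulLeft (b i)).comp ((φ : ℤ_[p] →+ O).comp (zc i)), fun y ↦ by
      rw [AddMonoidHom.finsetSum_apply]; rfl⟩
  refine ⟨z, fun m ↦ ?_⟩
  -- the orbit polynomial of `z` is `Σ_i b_i · (orbit polynomial of z_i)` (polynomial level)
  have hpoly : (∑ j ∈ range (N m), C (z (x m j)) * (X + 1) ^ j : O[X]) =
      ∑ i, C (b i) * (∑ j ∈ range (N m), C (zc i (x m j)) * (X + 1) ^ j).map φ := by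
    have h1 : ∀ j ∈ range (N m), (C (z (x m j)) * (X + 1) ^ j : O[X]) =
        ∑ i, C (b i) * (C (φ (zc i (x m j))) * (X + 1) ^ j) := fun j _ ↦ by
      rw [hz, map_sum, Finset.sum_mul]
      refine Finset.sum_congr rfl fun i _ ↦ ?_
      rw [map_mul, mul_assoc]
    have h2 : ∀ i ∈ (Finset.univ : Finset (Module.Free.ChooseBasisIndex ℤ_[p] O)),
        (C (b i) * (∑ j ∈ range (N m), C (zc i (x m j)) * (X + 1) ^ j).map φ : O[X]) =
          ∑ j ∈ range (N m), C (b i) * (C (φ (zc i (x m j))) * (X + 1) ^ j) := fun i _ ↦ by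
      rw [Polynomial.map_sum, Finset.mul_sum]
      refine Finset.sum_congr rfl fun j _ ↦ ?_
      rw [Polynomial.map_mul, Polynomial.map_pow, Polynomial.map_add, Polynomial.map_X, Polynomial.map_one,
        Polynomial.map_C]
    rw [Finset.sum_congr rfl h1, Finset.sum_congr rfl h2, Finset.sum_comm]
  -- … and at the power-series level
  have horb : ((∑ j ∈ range (N m), C (z (x m j)) * (X + 1) ^ j : O[X]) : PowerSeries O) =
      ∑ i, PowerSeries.C (b i) *
        PowerSeries.map φ ((∑ j ∈ range (N m), C (zc i (x m j)) * (X + 1) ^ j : ℤ_[p][X]) : PowerSeries ℤ_[p]) := by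
    rw [hpoly, ← Polynomial.coeToPowerSeries.ringHom_apply, map_sum]
    refine Finset.sum_congr rfl fun i _ ↦ ?_
    rw [map_mul, Polynomial.coeToPowerSeries.ringHom_apply, Polynomial.coeToPowerSeries.ringHom_apply, Polynomial.coe_C,
      Polynomial.polynomial_map_coe]
  -- each coordinate congruence, mapped to `𝒪⟦T⟧` and weighted by `b_i`
  have hi : ∀ i, (((ω m).map (Int.castRingHom O) : O[X]) : PowerSeries O) ∣
      PowerSeries.C (b i) * (PowerSeries.map φ ((∑ j ∈ range (N m), C (zc i (x m j)) * (X + 1) ^ j : ℤ_[p][X]) : PowerSeries ℤ_[p]) +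
        (s m : PowerSeries O) * (((ω' m).map (Int.castRingHom O) : O[X]) : PowerSeries O) * PowerSeries.map φ (Fc i)) := by
    intro i
    refine Dvd.dvd.mul_left ?_ _
    have h := map_dvd (PowerSeries.map φ) (hzc i m)
    rw [map_add, map_mul, map_mul, map_intCast] at h
    rwa [coe_map_intCastRingHom_eq_map (p := p) (ω m), coe_map_intCastRingHom_eq_map (p := p) (ω' m)]
  have hsum := Finset.dvd_sum fun i (_ : i ∈ (Finset.univ : Finset (Module.Free.ChooseBasisIndex ℤ_[p] O))) ↦ hi i
  have htarget : ((∑ j ∈ range (N m), C (z (x m j)) * (X + 1) ^ j : O[X]) : PowerSeries O) +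
      (s m : PowerSeries O) * (((ω' m).map (Int.castRingHom O) : O[X]) : PowerSeries O) * F =
      ∑ i, PowerSeries.C (b i) *
        (PowerSeries.map φ ((∑ j ∈ range (N m), C (zc i (x m j)) * (X + 1) ^ j : ℤ_[p][X]) : PowerSeries ℤ_[p]) +
          (s m : PowerSeries O) * (((ω' m).map (Int.castRingHom O) : O[X]) : PowerSeries O) * PowerSeries.map φ (Fc i)) := by
    rw [horb, hF, Finset.mul_sum, ← Finset.sum_add_distrib]
    refine Finset.sum_congr rfl fun i _ ↦ ?_
    ring
  rw [htarget]
  exact hsum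

end Coeff

/-! ## §2 `p = 2`: `Col⁺ ⊗ 𝒪` is onto `Λ_𝒪 = 𝒪⟦T⟧` on the cyclotomic `ℤ₂`-tower -/

section Two

open NumberField IsDedekindDomain WeierstrassCurve Literature.NumberTheory.EllipticCurves.Rank1Residual

variable (W : WeierstrassCurve ℚ) [W.IsElliptic] [W.IsGloballyMinimal]
variable (O : Type*) [CommRing O] [Algebra ℤ_[2] O] [Module.Free ℤ_[2] O] [Module.Finite ℤ_[2] O]

/-- **`Col⁺ ⊗ 𝒪 : Hom(E(ℚ_{2,∞}·ℚ_v), 𝒪) → Λ_𝒪` is ONTO at `p = 2`** (functional model; Kobayashi Thm. 6.2 (6.13) with coefficients): for every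
globally minimal `W/ℚ` with `GoodSS W 2`, `a₂(W) = 0`, the cyclotomic `κ`, `v ∋ 2`, and `𝒪` finite free over `ℤ₂`, there are a local lift `g` of the
topological generator and a plus Honda family `d` ((L), (TR), (ND); all `gʲ·d_m` in the tower) such that EVERY `F ∈ 𝒪⟦T⟧` is the plus Coleman
value of some `𝒪`-valued functional `z`: `ω_{2m} ∣ Σ_{j<4^m} C(z(gʲ·d_{2m}))(X+1)^j + (−1)^m·ω⁻_{2m}·F` for all `m` (Sprung's even-level sign convention at
`a_p = 0`). Proof: `colemanFlat_onto_two` (`𝒪 = ℤ₂`) coordinatewise in a `ℤ₂`-basis of `𝒪` (`exists_addMonoidHom_coeff_of_forall_exists`).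
[cite: Kobayashi2003, Thm. 6.2 (6.13) (p. 11)] [cite: Sprung2012, Prop. 7.3 (p. 1500) and Def. 5.9] [cite: Sprung2017, Cor. 4.4] -/
theorem colemanPlus_onto_two_coeff (hss : GoodSS W 2) (ha : W.frobeniusTrace 2 = 0) (κ : ZpExtension ℚ 2) (hκ : κ.IsCyclotomic)
    (v : HeightOneSpectrum (𝓞 ℚ)) (hv : (2 : 𝓞 ℚ) ∈ v.asIdeal) :
    ∃ (g : Field.absoluteGaloisGroup (v.adicCompletion ℚ)) (d : ℕ → localPoints W (v.adicCompletion ℚ))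
      (hd : ∀ m j, g ^ j • d m ∈ Sprung2012.localTowerPointsOfEmb κ (closureEmb (K := ℚ) (v.adicCompletion ℚ)) W),
      κ.IsTopGenerator (resGalOfEmb (closureEmb (K := ℚ) (v.adicCompletion ℚ)) g) ∧
      (∀ m, d m ∈ localLayerPointsOfEmb κ (closureEmb (K := ℚ) (v.adicCompletion ℚ)) W m) ∧
      (∀ m, localTraceOfEmb κ (closureEmb (K := ℚ) (v.adicCompletion ℚ)) W (m + 1) (m + 2) (d (m + 2)) = -d m) ∧
      (∀ b ∈ localLayerPointsOfEmb κ (closureEmb (K := ℚ) (v.adicCompletion ℚ)) W 0, d 0 ≠ 2 • b) ∧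
      ∀ F : PowerSeries O, ∃ z : Sprung2012.localTowerPointsOfEmb κ (closureEmb (K := ℚ) (v.adicCompletion ℚ)) W →+ O,
        ∀ m : ℕ,
          (((cyclotomicOmega 2 (2 * m)).map (Int.castRingHom O) : O[X]) : PowerSeries O) ∣
            ((∑ j ∈ range (2 ^ (2 * m)), C (z ⟨g ^ j • d (2 * m), hd (2 * m) j⟩) * (X + 1) ^ j : O[X]) : PowerSeries O) +
              (-1 : PowerSeries O) ^ m * (((cyclotomicOmegaMinus 2 (2 * m)).map (Int.castRingHom O) : O[X]) : PowerSeries O) * F := by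
  obtain ⟨g, d, hg, hL, hTR, hND, honto⟩ := colemanFlat_onto_two W hss ha κ hκ v hv
  set ι := closureEmb (K := ℚ) (v.adicCompletion ℚ) with hι
  have hd : ∀ m j, g ^ j • d m ∈ Sprung2012.localTowerPointsOfEmb κ ι W := fun m j ↦
    Sprung2012.smul_mem_localTowerPointsOfEmb κ ι W _ (Sprung2012.localLayerPointsOfEmb_le_localTowerPointsOfEmb κ ι W m (hL m))
  refine ⟨g, d, hd, hg, hL, hTR, hND, fun F ↦ ?_⟩
  -- the `ℤ₂`-valued onto statement in the shape of §1
  have honto' : ∀ a : PowerSeries ℤ_[2], ∃ z : Sprung2012.localTowerPointsOfEmb κ ι W →+ ℤ_[2], ∀ m : ℕ,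
      (((cyclotomicOmega 2 (2 * m)).map (Int.castRingHom ℤ_[2]) : ℤ_[2][X]) : PowerSeries ℤ_[2]) ∣
        ((∑ j ∈ range (2 ^ (2 * m)), C (z ⟨g ^ j • d (2 * m), hd (2 * m) j⟩) * (X + 1) ^ j : ℤ_[2][X]) : PowerSeries ℤ_[2]) +
          (((-1 : ℤ) ^ m : ℤ) : PowerSeries ℤ_[2]) *
            (((cyclotomicOmegaMinus 2 (2 * m)).map (Int.castRingHom ℤ_[2]) : ℤ_[2][X]) : PowerSeries ℤ_[2]) * a := by
    intro a
    obtain ⟨z, Ls, hz⟩ := honto a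
    refine ⟨z, fun m ↦ ?_⟩
    have h := hz (2 * m)
    rw [sharpPoly_zero_of_even 2 (even_two_mul m), flatPoly_zero_of_even 2 (even_two_mul m),
      show 2 * m / 2 = m by omega, map_zero, zero_mul, zero_add, toIwasawa_apply, toIwasawa_apply,
      pairingSum_eq_coe_orbitSum, Polynomial.map_mul, Polynomial.map_pow, Polynomial.map_neg, Polynomial.map_one,
      Polynomial.coe_mul, Polynomial.coe_pow, Polynomial.coe_neg, Polynomial.coe_one] at h
    rw [Finset.sum_congr rfl fun j _ ↦ by rw [Sprung2012.evalOn_of_mem W _ z (hd (2 * m) j)]] at h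
    convert h using 2
    push_cast
    ring
  obtain ⟨z, hz⟩ := exists_addMonoidHom_coeff_of_forall_exists (O := O)
    (fun m j ↦ (⟨g ^ j • d (2 * m), hd (2 * m) j⟩ : Sprung2012.localTowerPointsOfEmb κ ι W)) (fun m ↦ 2 ^ (2 * m))
    (fun m ↦ cyclotomicOmega 2 (2 * m)) (fun m ↦ cyclotomicOmegaMinus 2 (2 * m)) (fun m ↦ (-1) ^ m) honto' F
  refine ⟨z, fun m ↦ ?_⟩
  have h := hz m
  push_cast at h
  exact h

/-- **`Col⁺ ⊗ 𝒪` onto `Λ_𝒪` at `p = 2` on the crux's carriers** `𝒪 = padicCoeffIntegers S`, `Λ_𝒪 = IwasawaAlgebraO S` (`ℚ₂(S)/ℚ₂` finite; for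
RSL_g: `S = Set.range ι`): the statement of `colemanPlus_onto_two_coeff` verbatim (finite freeness over `ℤ₂` from
`PadicIntermediateField.moduleFree_unitBall` / `moduleFinite_unitBall` along `padicCoeffIntegers_eq_unitBall`).
[cite: Kobayashi2003, Thm. 6.2 (6.13) (p. 11)] [cite: Sprung2012, Prop. 7.3 (p. 1500)] -/
theorem colemanPlus_onto_two_padicCoeffIntegers (hss : GoodSS W 2) (ha : W.frobeniusTrace 2 = 0) (κ : ZpExtension ℚ 2)
    (hκ : κ.IsCyclotomic) (v : HeightOneSpectrum (𝓞 ℚ)) (hv : (2 : 𝓞 ℚ) ∈ v.asIdeal) (S : Set (PadicAlgCl 2))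
    [FiniteDimensional ℚ_[2] (padicCoeffField S)] :
    ∃ (g : Field.absoluteGaloisGroup (v.adicCompletion ℚ)) (d : ℕ → localPoints W (v.adicCompletion ℚ))
      (hd : ∀ m j, g ^ j • d m ∈ Sprung2012.localTowerPointsOfEmb κ (closureEmb (K := ℚ) (v.adicCompletion ℚ)) W),
      κ.IsTopGenerator (resGalOfEmb (closureEmb (K := ℚ) (v.adicCompletion ℚ)) g) ∧
      (∀ m, d m ∈ localLayerPointsOfEmb κ (closureEmb (K := ℚ) (v.adicCompletion ℚ)) W m) ∧
      (∀ m, localTraceOfEmb κ (closureEmb (K := ℚ) (v.adicCompletion ℚ)) W (m + 1) (m + 2) (d (m + 2)) = -d m) ∧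
      (∀ b ∈ localLayerPointsOfEmb κ (closureEmb (K := ℚ) (v.adicCompletion ℚ)) W 0, d 0 ≠ 2 • b) ∧
      ∀ F : IwasawaAlgebraO S,
        ∃ z : Sprung2012.localTowerPointsOfEmb κ (closureEmb (K := ℚ) (v.adicCompletion ℚ)) W →+ padicCoeffIntegers S,
        ∀ m : ℕ,
          (((cyclotomicOmega 2 (2 * m)).map (Int.castRingHom (padicCoeffIntegers S)) : (padicCoeffIntegers S)[X]) :
              IwasawaAlgebraO S) ∣
            ((∑ j ∈ range (2 ^ (2 * m)), C (z ⟨g ^ j • d (2 * m), hd (2 * m) j⟩) * (X + 1) ^ j : (padicCoeffIntegers S)[X]) :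
                IwasawaAlgebraO S) +
              (-1 : IwasawaAlgebraO S) ^ m *
                (((cyclotomicOmegaMinus 2 (2 * m)).map (Int.castRingHom (padicCoeffIntegers S)) : (padicCoeffIntegers S)[X]) :
                  IwasawaAlgebraO S) * F := by
  unfold IwasawaAlgebraO
  rw [padicCoeffIntegers_eq_unitBall S]
  exact colemanPlus_onto_two_coeff W _ hss ha κ hκ v hv

end Two

end Summit.BirchSwinnertonDyer.BirchSwinnertonDyer.Theorems.SignedColemanImage

end
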